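import Literature.AnabelianGeometry.EtaleTheta.Discharge.Sec5Lem59vUniversalClosureRefuted
import Literature.AnabelianGeometry.EtaleTheta.Discharge.Sec5EnvAut
import Mathlib.GroupTheory.SpecificGroups.Cyclic

/-!
# [EtTh] §5 / §2: a §2 datum with cyclotome `μ_3` over w5-d026's toy §5 datum; `Facts`, `D_Y = 1`, `D = ⟨DK⟩`, `Out(E^Π_N) ≠ 1` (Lemma 5.9 (iv), p. 332 / PDF p. 106)

Mochizuki, *The étale theta function and its Frobenioid-theoretic manifestations*, Publ. RIMS **45**
(2009) [cite: MochizukiEtTh2009, Lem 5.9 (iv) p.332 (PDF p.106)].  abc-iut cell, block F, seat abc-iut-f-123 (owner of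
tranche 123: FACT-LIST rows F-0545 `EnvIsoBiTheta`, F-0546 `FrdIsMonoThetaEnv` of abc-iut-L2-t4's
`FrobenioidMonoThetaEnv.lean`).  DATA file (one definition) for the sequel `Discharge/Sec5Lem59ivToyMuThreeInstance.lean`
(instances and criteria for F-0545/F-0546 at a datum with NON-trivial cyclotome), over abc-iut-w5-d026's toy §5 datum
`Lem59vToy.toyTheta₃` (`Discharge/Sec5Lem59vUniversalClosureRefuted.lean`: `C := SingleObj ℤ/3`,
`Aut_C(⋆) = O^×(⋆) = μ_3(⋆) = ℤ/3`, `N = 3`, `Π^tp_X̲ = ℤ × ℤ/2` discrete, `Π^tp_Ÿ̲ = 1`, all sections trivial) — imported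
BY NAME, nothing edited.

WHAT IS BUILT (one definition): `Lem59vToy.thetaEnvData₃ : ThetaEnvData 3` — abc-iut-L2-t2's §2 interface over the SAME
`Π^tp_X = ℤ × ℤ/2` (`G_K := Π^tp_X`, `Π^tp_Y = 0 × ℤ/2`, `Π^tp_Ÿ = 1`) with cyclotome `μ_3 = ℤ/3`, TRIVIAL cyclotomic
character and the one-element collection `{1}` of theta cocycles.  PROVED (FQ prefix
`Literature.AnabelianGeometry.EtaleTheta.ThetaFrobenioid.Lem59vToy.`): `facts_toy₃` — abc-iut-L2-t4's bundle
`ThetaFrobenioid.Facts` of printed §5 inputs HOLDS at `toyTheta₃` (so w5-d026's F-0544 countermodel lives at a datum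
satisfying every §5 input); `mem_muTorsion_toy₃` (`μ_3(⋆) = Aut(⋆)`); `shift_eq_one₃` (a `χ`-trivial envelope cocycle
`Π^tp_Y ≅ ℤ/2 → μ_3` is trivial), `conjX_eq_one₃`, **`DY_eq_bot₃`** (`D_Y = 1`); `conjOut_eq_one₃`, **`frdD_eq_closure₃`**
(`D = ⟨DK⟩` on the §5 side: the ambient group `Aut_C(⋆) × Π^tp_X̲` is abelian); **`exists_topOut_ne_one₃`** (`Out(E^Π_N) ≠ 1`:
the class of inversion of the abelian `E^Π_N ≅ ℤ/3 × ℤ/2`, which moves `(g₀, 1)`).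
HONEST FRAMING: a toy datum over the one-object category `SingleObj ℤ/3` with abelian `Π^tp_X̲`; it is NOT the tempered
Frobenioid of a curve and says nothing about [EtTh]'s theorems for the genuine data; no FACT-LIST row is thereby proved;
typed ≠ proved; nothing here bears on [IUTchIII] Cor. 3.12 and no side is taken.
-/

noncomputable section

namespace Literature.AnabelianGeometry.EtaleTheta

namespace ThetaFrobenioid

namespace Lem59vToy

open CategoryTheory Literature.AlgebraicGeometry.Frobenioids
open ConstantMultiple.Cor512Toy (Mm TD kerFstEquiv)

/-! ### Small facts about `ℤ/3`, `ℤ × ℤ/2` and the toy datum's fields -/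

/-- In `ℤ/3`: an element of order dividing `2` is trivial. [folklore] -/
private theorem M3_eq_one_of_mul_self : ∀ x : M3, x * x = 1 → x = 1 := by decide

/-- Every element of `ℤ/3` has cube `1`. [folklore] -/
private theorem M3_pow_three : ∀ x : M3, x ^ 3 = 1 := by decide

/-- The generator of `ℤ/3` is not an involution. [folklore] -/
private theorem g0_mul_g0_ne_one : g0 * g0 ≠ 1 := by decide

/-- Elements of `Π^tp_Y = 0 × ℤ/2` square to `1`. [cite: MochizukiEtTh2009, §2 p.267 (PDF p.41)] -/
theorem kerFst_mul_self (y : (MonoidHom.fst (Multiplicative ℤ) Mm).ker) : y * y = 1 := by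
  obtain ⟨⟨a, m⟩, h⟩ := y
  have ha : a = 1 := (MonoidHom.mem_ker).mp h
  subst ha
  apply Subtype.ext
  change ((1 : Multiplicative ℤ) * 1, m * m) = ((1 : Multiplicative ℤ), (1 : Mm))
  have hm : ∀ m : Mm, m * m = 1 := by decide
  rw [one_mul, hm]

/-- `s^⊓-gp_N = 1` in the toy datum. [cite: MochizukiEtTh2009, §5 p.331 (PDF p.105)] -/
theorem toyTheta₃_sgpCap : toyTheta₃.sgpCap = 1 := rfl

/-- `s^⊔-gp_N = 1` in the toy datum. [cite: MochizukiEtTh2009, §5 p.331 (PDF p.105)] -/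
theorem toyTheta₃_sgpCup : toyTheta₃.sgpCup = 1 := rfl

/-- Automorphism groups of the constant base `D = Discrete PUnit` are trivial.
[cite: MochizukiEtTh2009, §5 p.330 (PDF p.104)] -/
theorem subsingleton_aut_base (S : TC3) : Subsingleton (Aut (toyTheta₃.base.obj S)) :=
  ⟨fun _ _ => Iso.ext (Subsingleton.elim _ _)⟩

/-- Every automorphism of `⋆` lies in `μ_3(⋆)` (it is a unit with cube `1`).
[cite: MochizukiEtTh2009, Def 5.4 p.327 (PDF p.101)] -/
theorem mem_muTorsion_toy₃ (S : TC3) (a : Aut S) : a ∈ toyTheta₃.muTorsion S toyTheta₃.N := by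
  refine toyTheta₃.mem_muTorsion.mpr ⟨mem_unitsSubgroup_toy S a, ?_⟩
  apply Aut.ext
  have h : autToM3 S (a ^ 3) = 1 := by rw [map_pow]; exact M3_pow_three _
  exact h

/-- The ambient group `Aut_C(B_N) × Π^tp_X̲` of `E^Π_N` is abelian in the toy datum.
[cite: MochizukiEtTh2009, Lem 5.9 (iv) p.332 (PDF p.106)] -/
theorem ambient_comm₃ (a b : Aut toyTheta₃.BN × toyTheta₃.PiX) : a * b = b * a :=
  Prod.ext (aut_mul_comm₃ _ _ _) (@mul_comm (Multiplicative ℤ × Mm) _ a.2 b.2)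

/-- `E^Π_N` is abelian in the toy datum. [cite: MochizukiEtTh2009, Lem 5.9 (iv) p.332 (PDF p.106)] -/
theorem epin_comm₃ (x y : toyTheta₃.EPiN) : x * y = y * x :=
  Subtype.ext (ambient_comm₃ _ _)

/-! ### The hypothesis bundle `Facts` holds at the toy datum -/

/-- abc-iut-L2-t4's bundle `Facts` of printed §5 inputs (`SgpCapSpec`, `SgpCupSpec`, `StrvSection`,
`BiKummerDifferenceMem`, `AutAmpleBN`, `ConstantsActByCyclotome`, `Epi s^⊓_N`, `Epi s^⊔_N`) holds at w5-d026's toy datum: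
all sections are trivial, the base is trivial, every automorphism of `⋆` is a unit annihilated by `N = 3`, and
`(K^×)^{1/N}` is everything (`K^× = 1`).  [cite: MochizukiEtTh2009, §5 pp.330–331 (PDF pp.104–105)] -/
theorem facts_toy₃ : toyTheta₃.Facts := by
  haveI := subsingleton_aut_base toyTheta₃.BN
  haveI := subsingleton_aut_base toyTheta₃.AN
  refine ⟨fun _ => rfl, fun _ => rfl, fun _ => Subsingleton.elim _ _, fun h => ?_, fun a => ⟨1, Subsingleton.elim _ _⟩,
    fun u => ?_, ?_, ?_⟩
  · rw [toyTheta₃_sgpCup, toyTheta₃_sgpCap, MonoidHom.one_apply, MonoidHom.one_apply, inv_one, mul_one]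
    exact Subgroup.one_mem _
  · constructor
    · intro hu
      refine ⟨toyTheta₃.OKxRootN_le_units hu, fun y _ => ?_⟩
      rw [toyTheta₃_sgpCap, MonoidHom.one_apply, one_mul, inv_one, mul_one, mul_inv_cancel]
      exact Subgroup.one_mem _
    · rintro ⟨hu, -⟩
      refine ⟨⟨u, hu⟩, ?_, rfl⟩
      change (toyTheta₃.unitsToBirat toyTheta₃.BN ⟨u, hu⟩) ^ ((toyTheta₃.N : ℕ+) : ℕ) ∈ toyTheta₃.constEmb.range
      have hz : (toyTheta₃.unitsToBirat toyTheta₃.BN ⟨u, hu⟩ : M3) ^ ((toyTheta₃.N : ℕ+) : ℕ) = 1 := M3_pow_three _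
      rw [hz]
      exact Subgroup.one_mem _
  · change Epi (𝟙 _); infer_instance
  · change Epi (𝟙 _); infer_instance

/-! ### The §2 datum `thetaEnvData₃ : ThetaEnvData 3` over the same `Π^tp_X`, with cyclotome `μ_3` -/

/-- `[Π^tp_Y : Π^tp_Ÿ] = [0 × ℤ/2 : 1] = 2`. [cite: MochizukiEtTh2009, §2 p.267 (PDF p.41)] -/
theorem index_PiYdd₃ :
    ((⊥ : Subgroup (Multiplicative ℤ × Mm)).subgroupOf (MonoidHom.fst (Multiplicative ℤ) Mm).ker).index = 2 := by
  rw [Subgroup.bot_subgroupOf, Subgroup.index_bot, Nat.card_congr kerFstEquiv, Nat.card_zmod]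

/-- **The §2 datum `ThetaEnvData 3` with non-trivial cyclotome**: `Π^tp_X := ℤ × ℤ/2` (discrete), `G_K := Π^tp_X`,
`Π^tp_Y := Ker(pr₁) = 0 × ℤ/2` with `Π^tp_X/Π^tp_Y ≅ ℤ`, `Π^tp_Ÿ := 1` (index `2`), `μ_3 := ℤ/3` with the TRIVIAL character,
and the one-element collection `{1}` of theta cocycles on `Π^tp_Ÿ = 1`.
[cite: MochizukiEtTh2009, Def 2.13 p.273 (PDF p.47)] -/
def thetaEnvData₃ : ThetaEnvData.{0} 3 where
  PiX := Multiplicative ℤ × Mm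
  G := Multiplicative ℤ × Mm
  aug := MonoidHom.id _
  aug_surjective := Function.surjective_id
  PiY := (MonoidHom.fst (Multiplicative ℤ) Mm).ker
  PiY_normal := inferInstance
  PiY_open := isOpen_discrete _
  galYX := QuotientGroup.quotientKerEquivOfSurjective (MonoidHom.fst (Multiplicative ℤ) Mm) fun z => ⟨(z, 1), rfl⟩
  PiYdd := ⊥
  PiYdd_le := bot_le
  PiYdd_normal := inferInstance
  PiYdd_open := isOpen_discrete _
  index_PiYdd := index_PiYdd₃
  mu := M3
  topMu := ⊥
  discMu := ⟨rfl⟩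
  finMu := inferInstance
  mu_cyclic := inferInstance
  card_mu := rfl
  chi := 1
  chi_ker_open := isOpen_discrete _
  thetaCocycles := {1}
  thetaCocycles_nonempty := Set.singleton_nonempty _
  isCocycle := by
    rintro η rfl g h
    rfl
  locallyConstant η _ := IsLocallyConstant.of_discrete η
  mul_coboundary_mem := by
    rintro η rfl c
    rw [Set.mem_singleton_iff]
    funext g
    change (1 : M3) * (c * ((1 : MulAut M3) c)⁻¹) = 1
    rw [MulAut.one_apply, mul_inv_cancel, mul_one]

/-- The cyclotomic character of `thetaEnvData₃` is trivial (pointwise). [cite: MochizukiEtTh2009, Def 2.13 p.273 (PDF p.47)] -/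
theorem chi₃_apply (g : thetaEnvData₃.G) (a : thetaEnvData₃.mu) : thetaEnvData₃.chi g a = a := rfl

/-- **A `χ`-trivial envelope cocycle on `Π^tp_Y = 0 × ℤ/2` with values in `μ_3` is trivial**: it is a homomorphism
from a group of exponent `2` to a group of exponent `3`.  [cite: MochizukiEtTh2009, Prop 2.14 (ii) p.275 (PDF p.49)] -/
theorem cocycle_apply_eq_one₃ {δ : thetaEnvData₃.PiY → thetaEnvData₃.mu}
    (hδ : CycEnvelope.IsEnvCocycle thetaEnvData₃.augY thetaEnvData₃.chi δ) (y : thetaEnvData₃.PiY) : δ y = 1 := by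
  have h1 : δ 1 = 1 := by
    have := hδ 1 1
    rw [mul_one, chi₃_apply] at this
    exact mul_eq_left.mp this.symm
  have h2 : δ y * δ y = 1 := by
    have := hδ y y
    have hy : y * y = 1 := kerFst_mul_self y
    rw [chi₃_apply, hy, h1] at this
    exact this.symm
  exact M3_eq_one_of_mul_self _ h2

/-- Every Kummer shift of `Π^tp_Y[μ_3]` is the identity for `thetaEnvData₃`.
[cite: MochizukiEtTh2009, Prop 2.14 (ii) p.275 (PDF p.49)] -/
theorem shift_eq_one₃ {δ : thetaEnvData₃.PiY → thetaEnvData₃.mu}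
    (hδ : CycEnvelope.IsEnvCocycle thetaEnvData₃.augY thetaEnvData₃.chi δ) : CycEnvelope.shift hδ = 1 := by
  refine MulEquiv.ext fun x => SemidirectProduct.ext ?_ rfl
  change x.left * δ x.right = x.left
  rw [cocycle_apply_eq_one₃ hδ, mul_one]

/-- Every `Gal(Y/X)`-conjugation of `Π^tp_Y[μ_3]` is the identity for `thetaEnvData₃` (`Π^tp_X` abelian, `χ` trivial).
[cite: MochizukiEtTh2009, Def 2.13 (i) p.273 (PDF p.47)] -/
theorem conjX_eq_one₃ (g : thetaEnvData₃.PiX) : thetaEnvData₃.conjX g = 1 := by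
  refine MulEquiv.ext fun x => SemidirectProduct.ext ?_ (Subtype.ext ?_)
  · exact chi₃_apply _ _
  · change g * (x.right : thetaEnvData₃.PiX) * g⁻¹ = (x.right : thetaEnvData₃.PiX)
    have hc : g * (x.right : thetaEnvData₃.PiX) = (x.right : thetaEnvData₃.PiX) * g :=
      @mul_comm (Multiplicative ℤ × Mm) _ _ _
    rw [hc, mul_inv_cancel_right]

/-- **`D_Y = 1`** for `thetaEnvData₃`: abc-iut-L2-t2's `D_Y = ⟨kummerOut ∪ galOut⟩` is generated by identities.
[cite: MochizukiEtTh2009, Def 2.13 (i) p.273 (PDF p.47)] -/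
theorem DY_eq_bot₃ : thetaEnvData₃.DY = ⊥ := by
  rw [ThetaEnvData.DY, Subgroup.closure_eq_bot_iff]
  rintro d (⟨δ, hδ, hc, rfl⟩ | ⟨g, hc, rfl⟩)
  · have h1 : (⟨CycEnvelope.shift hδ, hc⟩ : contMulAut thetaEnvData₃.env) = 1 := Subtype.ext (shift_eq_one₃ hδ)
    rw [Set.mem_singleton_iff, h1, map_one]
  · have h1 : (⟨thetaEnvData₃.conjX g, hc⟩ : contMulAut thetaEnvData₃.env) = 1 := Subtype.ext (conjX_eq_one₃ g)
    rw [Set.mem_singleton_iff, h1, map_one]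

/-! ### `D = ⟨DK⟩` on the §5 side: the outer actions of `l·ℤ` and of the constants are trivial at the toy datum -/

/-- Conjugation by an element of the normaliser of `E^Π_N` in the abelian ambient group is the trivial outer
automorphism.  [cite: MochizukiEtTh2009, Lem 5.9 (iii) p.332 (PDF p.106)] -/
theorem conjOut_eq_one₃ (n : Subgroup.normalizer (toyTheta₃.EPiN : Set (Aut toyTheta₃.BN × toyTheta₃.PiX))) :
    toyTheta₃.conjOut n = 1 := by
  have h : (⟨toyTheta₃.EPiN.normalizerMonoidHom n, toyTheta₃.normalizerMonoidHom_mem_contMulAut n⟩ :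
      contMulAut toyTheta₃.EPiN) = 1 := by
    apply Subtype.ext
    apply MulEquiv.ext
    intro x
    apply Subtype.ext
    change (n : Aut toyTheta₃.BN × toyTheta₃.PiX) * (x : Aut toyTheta₃.BN × toyTheta₃.PiX) *
        (n : Aut toyTheta₃.BN × toyTheta₃.PiX)⁻¹ = (x : Aut toyTheta₃.BN × toyTheta₃.PiX)
    rw [ambient_comm₃ (n : Aut toyTheta₃.BN × toyTheta₃.PiX), mul_inv_cancel_right]
  change TopOut.mk _ _ = 1
  rw [h, map_one]

/-- **`D = ⟨DK⟩`** at the toy datum. [cite: MochizukiEtTh2009, Lem 5.9 (iv) p.332 (PDF p.106)] -/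
theorem frdD_eq_closure₃ (h1 : toyTheta₃.SectionsFactor) (h3 : toyTheta₃.OuterActionLZ)
    (hsec : toyTheta₃.SgpCapSection) (hcs : toyTheta₃.SgpCupSection) (h8 : toyTheta₃.ConstantsEqNormalizer)
    (DK : Set (TopOut toyTheta₃.EPiN)) :
    (toyTheta₃.frdMonoThetaEnv h1 h3 hsec hcs h8 DK).D = Subgroup.closure DK := by
  change Subgroup.closure (toyTheta₃.galOut h3 hsec ∪ toyTheta₃.constOut h8 ∪ DK) = Subgroup.closure DK
  apply le_antisymm
  · rw [Subgroup.closure_le]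
    rintro d ((⟨g, rfl⟩ | ⟨u, rfl⟩) | hd)
    · dsimp only
      rw [conjOut_eq_one₃]
      exact Subgroup.one_mem _
    · dsimp only
      rw [conjOut_eq_one₃]
      exact Subgroup.one_mem _
    · exact Subgroup.subset_closure hd
  · exact Subgroup.closure_mono Set.subset_union_right

/-! ### Sharpness in `DK`: `Out(E^Π_N) ⊄ {1}` at the toy datum -/

/-- `(g₀, 1) ∈ E^Π_N` (`g₀ ∈ μ_3(⋆) ⊆ E_N`, `1 ∈ Π^tp_Y̲`, trivial base). [cite: MochizukiEtTh2009, Lem 5.9 (iv) p.332 (PDF p.106)] -/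
theorem g0_one_mem_EPiN : ((toAut3 _ g0 : Aut toyTheta₃.BN), (1 : toyTheta₃.PiX)) ∈ toyTheta₃.EPiN := by
  haveI := subsingleton_aut_base toyTheta₃.BN
  exact ⟨le_sectionSubgroup _ _ _ (mem_muTorsion_toy₃ _ _), toyTheta₃.PiY.one_mem, Subsingleton.elim _ _⟩

/-- Inversion on `E^Π_N` is continuous. [cite: MochizukiEtTh2009, Lem 5.9 (iv) p.332 (PDF p.106)] -/
theorem continuous_inv_EPiN₃ : Continuous fun x : toyTheta₃.EPiN => x⁻¹ :=
  ThetaFrobenioid.continuous_of_componentwise _ (fun a => a⁻¹) (fun y => y⁻¹) continuous_inv fun _ => rfl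

/-- **A non-trivial element of `Out(E^Π_N)` at the toy datum**: the class of inversion (not inner, since `E^Π_N ≅ ℤ/6`
is abelian and `(g₀, 1)` is not an involution).  [cite: MochizukiEtTh2009, Lem 5.9 (iv) p.332 (PDF p.106)] -/
theorem exists_topOut_ne_one₃ : ∃ d : TopOut toyTheta₃.EPiN, d ≠ 1 := by
  let φ₀ : MulAut toyTheta₃.EPiN :=
    { toFun := fun x => x⁻¹
      invFun := fun x => x⁻¹
      left_inv := fun x => inv_inv x
      right_inv := fun x => inv_inv x
      map_mul' := fun x y => (mul_inv_rev x y).trans (epin_comm₃ _ _) }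
  have hφ₀ : φ₀ ∈ contMulAut toyTheta₃.EPiN := ⟨continuous_inv_EPiN₃, continuous_inv_EPiN₃⟩
  refine ⟨TopOut.mk _ ⟨φ₀, hφ₀⟩, fun h => ?_⟩
  rw [QuotientGroup.mk'_apply, QuotientGroup.eq_one_iff, Subgroup.mem_subgroupOf] at h
  obtain ⟨g, hg⟩ := h
  let x₀ : toyTheta₃.EPiN := ⟨_, g0_one_mem_EPiN⟩
  have key := MulEquiv.congr_fun hg x₀
  rw [MulAut.conj_apply, epin_comm₃ g x₀, mul_inv_cancel_right] at key
  -- `key : x₀ = φ₀ x₀ = x₀⁻¹`; read off the `Aut_C(⋆) = ℤ/3` component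
  have k2 : autToM3 _ (toAut3 _ g0) = autToM3 _ (toAut3 _ g0)⁻¹ :=
    congrArg (fun z : toyTheta₃.EPiN => autToM3 _ (z : Aut toyTheta₃.BN × toyTheta₃.PiX).1) key
  rw [map_inv, eq_inv_iff_mul_eq_one] at k2
  exact g0_mul_g0_ne_one k2

/-- `Out(E^Π_N) ⊄ {1}`. [cite: MochizukiEtTh2009, Lem 5.9 (iv) p.332 (PDF p.106)] -/
theorem not_univ_subset_one₃ : ¬ ((Set.univ : Set (TopOut toyTheta₃.EPiN)) ⊆ {1}) := by
  intro h
  obtain ⟨d, hd⟩ := exists_topOut_ne_one₃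
  exact hd (h (Set.mem_univ d))

end Lem59vToy

end ThetaFrobenioid

end Literature.AnabelianGeometry.EtaleTheta

end
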